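import Mathlib
import HarnessLib
import Summits.QuantumFields.YangMills.Theorems.FemtoCurvatureSkewness.Negative.WeakCoupling

/-!
# `FemtoCurvatureSkewness` — helper for stub `InfraredFloor` of line `coupling-cubic-response`
(crux stmt-QuantumFields-9365): the skewness floor on femto windows, on compact coupling windows, and on
bounded families of volumes; reduction of the stub to its large-volume core

The line's stub R `InfraredFloor` (`Cruxes/FemtoCurvatureSkewness/Lines/coupling_cubic_response.lean`) asks: from
the GLOBAL SIGN `κ₃(L,β,n) > 0` (`β ≥ β_u`, `1 ≤ n ≤ L/8`, ALL tori `L`) and SIGNED RIGIDITY `c₃·Cov·√Cov ≤ κ₃` on the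
femto boxes `{β ≥ β₁, L·a(β) ≤ ℓ₁}` of an honest unit map `a`, derive the a-free FLOOR
`∀ ε > 0 ∃ δ > 0 ∀ L β n : n⁸Cov ≥ ε → n¹²|κ₃| ≥ δ` above a coupling, on all tori (`SkewnessFloor r`).  This file proves
the soft fragments of that implication that ARE theorems of the tree (Mathlib + `Negative/WeakCoupling.lean`), stated
over the landed vocabulary `plaq`, `wCov`, `kappa3` (`Cov` below is the axis covariance
`wCov r L β (plaq r L 0 0 1) (plaq r L (n e₂) 0 1)`, the line's `covAxis`):

* §1 `floor_of_rigidity_pt` / `floor_of_rigidity` / `floor_of_rigidity_on_femto_window`: ON THE FEMTO WINDOW the floor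
  holds with the explicit `δ = c₃·ε·√ε` — pure algebra: `ε ≤ n⁸Cov ⇒ n¹²κ₃ ≥ c₃(n⁸Cov)·√(n⁸Cov) ≥ c₃ε√ε`, using
  `√(n⁸C) = n⁴√C`;
* §2 `floor_on_fixed_torus` / `floor_on_compact_window`: from the global sign ALONE — continuity of `β ↦ κ₃(L,β,n)`
  (`continuous_kappa3`), the extreme value theorem on `[β_u, B]`, finitely many `(L,n)` with `8n ≤ L ≤ L₀` — one
  `δ(B, L₀) > 0` below `n¹²|κ₃|` on every COMPACT coupling window and bounded family of volumes (no covariance premise);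
  `FloorCompactWindow` is its closed form, the sub-goal registered on the crux item for this helper;
* §3 `floor_on_bounded_volumes`: for a unit map with `a(β) → 0` the two combine (at bounded `L`, large `β` is femto) to
  the stub's conclusion RESTRICTED TO `{L ≤ L₀}`, for every `L₀`; `floor_of_floor_at_large_volumes`: hence the stub's
  conclusion follows from the floor on the residual window alone.

WHAT REMAINS of `InfraredFloor` after these fragments is exactly the window `{L > L₀} ∩ {L·a(β) > ℓ₁}` (equivalently
`({β > B} ∪ {L > L₀}) ∩ {L·a(β) > ℓ₁}`, since `β > B(L₀)` and `L ≤ L₀` is femto): LARGE boxes at couplings below their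
femto threshold, i.e. triangles at confinement-scale separations pinned by `n⁸Cov ≥ ε`.  Uniformity of `δ` in the volume
there is infrared cutoff/volume regularity of the three-point function (decoupling + `E0′` at the confinement scale);
no tree or Literature fact supplies it, and nothing here asserts it.  The global sign and the rigidity enter ONLY as
hypotheses (they are the line's stubs S and the output of E+I+T respectively); nothing is posited, no `sorry`.
-/

noncomputable section

namespace Summit.QuantumFields.YangMills.Theorems.FemtoCurvatureSkewness

open Filter Topology
open Literature.MathematicalPhysics.QuantumFieldTheory
open Summit.QuantumFields.YangMills.Theorems.FemtoCurvatureSkewness.Negative (plaq wCov kappa3 continuous_kappa3)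

variable {G : Type} [Group G] [TopologicalSpace G] [IsTopologicalGroup G] [CompactSpace G]
  [MeasurableSpace G] [BorelSpace G]

/-! ## §1 The femto window: signed rigidity gives the floor with `δ = c₃ ε √ε` -/

omit [Group G] [TopologicalSpace G] [IsTopologicalGroup G] [CompactSpace G] [MeasurableSpace G] [BorelSpace G] in
/-- Pointwise algebra of the femto floor: `c₃·C·√C ≤ κ` and `ε ≤ n⁸C` (`c₃, ε ≥ 0`) give `c₃·ε·√ε ≤ n¹²|κ|`, because
`(n⁸C)·√(n⁸C) = n¹²·C√C` and `t ↦ t√t` is monotone on `t ≥ 0`. -/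
theorem floor_of_rigidity_pt {c₃ C κ ε : ℝ} (n : ℕ) (hc₃ : 0 ≤ c₃) (hε : 0 ≤ ε)
    (hrig : c₃ * C * Real.sqrt C ≤ κ) (hεC : ε ≤ (n : ℝ) ^ 8 * C) :
    c₃ * (ε * Real.sqrt ε) ≤ (n : ℝ) ^ 12 * |κ| := by
  set A := (n : ℝ) ^ 8 * C with hA
  have hmono : ε * Real.sqrt ε ≤ A * Real.sqrt A :=
    mul_le_mul hεC (Real.sqrt_le_sqrt hεC) (Real.sqrt_nonneg _) (hε.trans hεC)
  have hn4 : (0 : ℝ) ≤ (n : ℝ) ^ 4 := by positivity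
  have hn12 : (0 : ℝ) ≤ (n : ℝ) ^ 12 := by positivity
  have hAsqrt : Real.sqrt A = (n : ℝ) ^ 4 * Real.sqrt C := by
    rw [hA, show ((n : ℝ) ^ 8) = ((n : ℝ) ^ 4) ^ 2 by ring, Real.sqrt_mul (sq_nonneg _), Real.sqrt_sq hn4]
  have hkey : A * Real.sqrt A = (n : ℝ) ^ 12 * (C * Real.sqrt C) := by
    rw [hAsqrt, hA]; ring
  calc c₃ * (ε * Real.sqrt ε) ≤ c₃ * (A * Real.sqrt A) := mul_le_mul_of_nonneg_left hmono hc₃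
    _ = (n : ℝ) ^ 12 * (c₃ * C * Real.sqrt C) := by rw [hkey]; ring
    _ ≤ (n : ℝ) ^ 12 * κ := mul_le_mul_of_nonneg_left hrig hn12
    _ ≤ (n : ℝ) ^ 12 * |κ| := mul_le_mul_of_nonneg_left (le_abs_self _) hn12

/-- **Floor on the femto window** (unbundled, explicit constant): signed rigidity `c₃·Cov·√Cov ≤ κ₃` on
`{β ≥ β₁, L·a(β) ≤ ℓ₁, 1 ≤ n ≤ L/8}` gives the floor clause there, `ε ≤ n⁸Cov ⇒ c₃ε√ε ≤ n¹²|κ₃|`, for every `ε ≥ 0`. -/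
theorem floor_of_rigidity (r : LatticeRep G) (a : ℝ → ℝ) {β₁ ℓ₁ c₃ : ℝ} (hc₃ : 0 ≤ c₃)
    (hR : ∀ (L : ℕ) [NeZero L] (β : ℝ), β₁ ≤ β → (L : ℝ) * a β ≤ ℓ₁ → ∀ n : ℕ, 1 ≤ n → 8 * n ≤ L →
      c₃ * wCov r L β (plaq r L 0 0 1) (plaq r L (Pi.single (2 : Fin 4) ((n : ℕ) : ZMod L)) 0 1) *
          Real.sqrt (wCov r L β (plaq r L 0 0 1) (plaq r L (Pi.single (2 : Fin 4) ((n : ℕ) : ZMod L)) 0 1)) ≤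
        kappa3 r L β n)
    {ε : ℝ} (hε : 0 ≤ ε) (L : ℕ) [NeZero L] (β : ℝ) (n : ℕ) (hβ : β₁ ≤ β) (hL : (L : ℝ) * a β ≤ ℓ₁)
    (hn : 1 ≤ n) (h8 : 8 * n ≤ L)
    (hεC : ε ≤ (n : ℝ) ^ 8 * wCov r L β (plaq r L 0 0 1) (plaq r L (Pi.single (2 : Fin 4) ((n : ℕ) : ZMod L)) 0 1)) :
    c₃ * (ε * Real.sqrt ε) ≤ (n : ℝ) ^ 12 * |kappa3 r L β n| :=
  floor_of_rigidity_pt n hc₃ hε (hR L β hβ hL n hn h8) hεC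

/-- **Floor on the femto window, `SignedRigidity` shape.**  The line's `SignedRigidity r a` (taken as a HYPOTHESIS,
verbatim over the tree vocabulary) yields thresholds `β₁` and `ℓ₁ > 0` such that for every `ε > 0` some `δ > 0` (namely
`c₃ε√ε`) bounds `n¹²|κ₃|` below on `{β ≥ β₁, L·a(β) ≤ ℓ₁, 1 ≤ n ≤ L/8, n⁸Cov ≥ ε}` — the femto part of `SkewnessFloor`. -/
theorem floor_of_rigidity_on_femto_window (r : LatticeRep G) (a : ℝ → ℝ)
    (hR : ∃ (β₁ ℓ₁ c₃ : ℝ), 0 < ℓ₁ ∧ 0 < c₃ ∧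
      ∀ (L : ℕ) [NeZero L] (β : ℝ), β₁ ≤ β → (L : ℝ) * a β ≤ ℓ₁ → ∀ n : ℕ, 1 ≤ n → 8 * n ≤ L →
        0 < wCov r L β (plaq r L 0 0 1) (plaq r L (Pi.single (2 : Fin 4) ((n : ℕ) : ZMod L)) 0 1) ∧
        c₃ * wCov r L β (plaq r L 0 0 1) (plaq r L (Pi.single (2 : Fin 4) ((n : ℕ) : ZMod L)) 0 1) *
            Real.sqrt (wCov r L β (plaq r L 0 0 1) (plaq r L (Pi.single (2 : Fin 4) ((n : ℕ) : ZMod L)) 0 1)) ≤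
          kappa3 r L β n) :
    ∃ (β₁ ℓ₁ : ℝ), 0 < ℓ₁ ∧ ∀ ε : ℝ, 0 < ε → ∃ δ : ℝ, 0 < δ ∧
      ∀ (L : ℕ) [NeZero L] (β : ℝ) (n : ℕ), β₁ ≤ β → (L : ℝ) * a β ≤ ℓ₁ → 1 ≤ n → 8 * n ≤ L →
        ε ≤ (n : ℝ) ^ 8 * wCov r L β (plaq r L 0 0 1) (plaq r L (Pi.single (2 : Fin 4) ((n : ℕ) : ZMod L)) 0 1) →
        δ ≤ (n : ℝ) ^ 12 * |kappa3 r L β n| := by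
  obtain ⟨β₁, ℓ₁, c₃, hℓ₁, hc₃, h⟩ := hR
  refine ⟨β₁, ℓ₁, hℓ₁, fun ε hε => ⟨c₃ * (ε * Real.sqrt ε), mul_pos hc₃ (mul_pos hε (Real.sqrt_pos.2 hε)), ?_⟩⟩
  intro L _ β n hβ hL hn h8 hεC
  exact floor_of_rigidity r a hc₃.le (fun L _ β hβ hL n hn h8 => (h L β hβ hL n hn h8).2) hε.le L β n hβ hL hn h8
    hεC

/-! ## §2 The compact window: the global sign alone gives the floor on `[β_u, B] × {8n ≤ L ≤ L₀}` -/

omit [Group G] [TopologicalSpace G] [IsTopologicalGroup G] [CompactSpace G] [MeasurableSpace G] [BorelSpace G] in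
/-- `1 ≤ n` ⇒ `|κ| ≤ n¹²|κ|`. -/
theorem abs_le_pow_twelve_mul_abs {n : ℕ} (hn : 1 ≤ n) (κ : ℝ) : |κ| ≤ (n : ℝ) ^ 12 * |κ| :=
  le_mul_of_one_le_left (abs_nonneg κ) (one_le_pow₀ (by exact_mod_cast hn))

/-- **Floor on a fixed torus over a compact coupling window.**  If `κ₃(L,β,n) > 0` for `β ≥ β_u`, `1 ≤ n ≤ L/8` on the
torus `L`, then for every `B` some `δ > 0` satisfies `δ ≤ n¹²|κ₃(L,β,n)|` for all `β ∈ [β_u, B]`, `1 ≤ n ≤ L/8`: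
finitely many continuous (`continuous_kappa3`) positive functions on a compact interval have a common positive lower
bound (extreme value theorem, `IsCompact.exists_forall_le'`). -/
theorem floor_on_fixed_torus (r : LatticeRep G) {βu : ℝ} (L : ℕ) [NeZero L]
    (hpos : ∀ (β : ℝ) (n : ℕ), βu ≤ β → 1 ≤ n → 8 * n ≤ L → 0 < kappa3 r L β n) (B : ℝ) :
    ∃ δ : ℝ, 0 < δ ∧ ∀ (β : ℝ) (n : ℕ), βu ≤ β → β ≤ B → 1 ≤ n → 8 * n ≤ L →
      δ ≤ (n : ℝ) ^ 12 * |kappa3 r L β n| := by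
  -- for each admissible `n`, every small enough `δ > 0` is below the minimum of `κ₃(L,·,n)` on `[β_u, B]`
  have key : ∀ᶠ δ in 𝓝[>] (0 : ℝ), ∀ n ∈ Finset.range (L + 1), ∀ β : ℝ, βu ≤ β → β ≤ B → 1 ≤ n → 8 * n ≤ L →
      δ ≤ (n : ℝ) ^ 12 * |kappa3 r L β n| := by
    simp only [Filter.eventually_all_finset]
    intro n _
    by_cases hn : 1 ≤ n ∧ 8 * n ≤ L
    · obtain ⟨m, hm, hmle⟩ := (isCompact_Icc (a := βu) (b := B)).exists_forall_le'
        (continuous_kappa3 r L n).continuousOn (a := (0 : ℝ)) (fun β hβ => hpos β n hβ.1 hn.1 hn.2)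
      filter_upwards [mem_nhdsWithin_of_mem_nhds (Iic_mem_nhds hm)] with δ hδ β hβu hβB _ _
      calc δ ≤ m := Set.mem_Iic.1 hδ
        _ ≤ kappa3 r L β n := hmle β ⟨hβu, hβB⟩
        _ ≤ |kappa3 r L β n| := le_abs_self _
        _ ≤ (n : ℝ) ^ 12 * |kappa3 r L β n| := abs_le_pow_twelve_mul_abs hn.1 _
    · exact Filter.Eventually.of_forall fun δ β _ _ h1 h8 => (hn ⟨h1, h8⟩).elim
  obtain ⟨δ, hδ, hδpos⟩ := (key.and eventually_mem_nhdsWithin).exists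
  exact ⟨δ, Set.mem_Ioi.1 hδpos, fun β n hβu hβB hn h8 =>
    hδ n (Finset.mem_range.2 (by omega)) β hβu hβB hn h8⟩

/-- **Floor on a compact window (global sign alone).**  Positivity `κ₃(L,β,n) > 0` for `β ≥ β_u`, `1 ≤ n ≤ L/8` on all
tori gives, for every coupling ceiling `B` and every volume ceiling `L₀`, ONE `δ > 0` with `δ ≤ n¹²|κ₃(L,β,n)|` for all
`β ∈ [β_u, B]`, `1 ≤ n ≤ L/8`, `L ≤ L₀` — finitely many tori, each handled by `floor_on_fixed_torus`.  (The registered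
binder shape `∀ (L : ℕ) [NeZero L] …` of the line is kept.) -/
theorem floor_on_compact_window (r : LatticeRep G) {βu : ℝ}
    (hpos : ∀ (L : ℕ) [NeZero L] (β : ℝ) (n : ℕ), βu ≤ β → 1 ≤ n → 8 * n ≤ L → 0 < kappa3 r L β n)
    (B : ℝ) (L₀ : ℕ) :
    ∃ δ : ℝ, 0 < δ ∧ ∀ (L : ℕ) [NeZero L] (β : ℝ) (n : ℕ), βu ≤ β → β ≤ B → 1 ≤ n → 8 * n ≤ L → L ≤ L₀ →
      δ ≤ (n : ℝ) ^ 12 * |kappa3 r L β n| := by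
  induction L₀ with
  | zero =>
    refine ⟨1, one_pos, ?_⟩
    intro L _ β n _ _ _ _ hL0
    exact absurd (Nat.le_zero.1 hL0) (NeZero.ne L)
  | succ L₀ ih =>
    obtain ⟨δ₁, hδ₁, h₁⟩ := ih
    obtain ⟨δ₂, hδ₂, h₂⟩ := floor_on_fixed_torus r (L₀ + 1) (fun β n => hpos (L₀ + 1) β n) B
    refine ⟨min δ₁ δ₂, lt_min hδ₁ hδ₂, ?_⟩
    intro L _ β n hβu hβB hn h8 hL
    rcases Nat.lt_or_eq_of_le hL with hlt | heq
    · exact (min_le_left _ _).trans (h₁ L β n hβu hβB hn h8 (Nat.lt_succ_iff.1 hlt))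
    · subst heq
      exact (min_le_right _ _).trans (h₂ β n hβu hβB hn h8)

/-- **Sub-goal `FloorCompactWindow` of stub R `InfraredFloor`** (registered on the crux item; closed form of
`floor_on_compact_window`, for every compact `G` and every `LatticeRep`): the global sign `κ₃(L,β,n) > 0` (`β ≥ β_u`,
`1 ≤ n ≤ L/8`, all tori) alone yields, for every coupling ceiling `B` and volume ceiling `L₀`, one `δ > 0` below
`n¹²|κ₃(L,β,n)|` on `[β_u, B] × {1 ≤ n, 8n ≤ L ≤ L₀}`. -/
theorem FloorCompactWindow :
    ∀ (G : Type) [Group G] [TopologicalSpace G] [IsTopologicalGroup G] [CompactSpace G] [MeasurableSpace G]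
      [BorelSpace G] (r : LatticeRep G) (βu : ℝ),
      (∀ (L : ℕ) [NeZero L] (β : ℝ) (n : ℕ), βu ≤ β → 1 ≤ n → 8 * n ≤ L → 0 < kappa3 r L β n) →
      ∀ (B : ℝ) (L₀ : ℕ), ∃ δ : ℝ, 0 < δ ∧ ∀ (L : ℕ) [NeZero L] (β : ℝ) (n : ℕ),
        βu ≤ β → β ≤ B → 1 ≤ n → 8 * n ≤ L → L ≤ L₀ → δ ≤ (n : ℝ) ^ 12 * |kappa3 r L β n| := by
  intro G _ _ _ _ _ _ r βu hpos B L₀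
  exact floor_on_compact_window r hpos B L₀

/-! ## §3 Bounded families of volumes, and the reduction of the stub to its large-volume core -/

/-- **Floor on bounded volumes.**  If `κ₃ > 0` above `β_u` on all tori (global sign) and `c₃·Cov·√Cov ≤ κ₃` on the femto
boxes `{β ≥ β₁, L·a(β) ≤ ℓ₁}` of a unit map with `a(β) → 0` (signed rigidity), then for EVERY volume ceiling `L₀` the
skewness floor holds on `{L ≤ L₀}` above `max β_u β₁`: `∀ ε > 0 ∃ δ > 0, n⁸Cov ≥ ε ⇒ n¹²|κ₃| ≥ δ`.  (At volumes `L ≤ L₀`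
every coupling beyond some `B` is femto, `L·a(β) ≤ L₀·a(β) < ℓ₁`, and `[max β_u β₁, B]` is compact.)  This is the line's
`SkewnessFloor r` restricted to a bounded family of volumes; only the uniformity of `δ` in `L₀` — the window
`{L > L₀} ∩ {L·a(β) > ℓ₁}` — separates it from the conclusion of stub `InfraredFloor`. -/
theorem floor_on_bounded_volumes (r : LatticeRep G) {a : ℝ → ℝ} (ha : Tendsto a atTop (𝓝 0))
    {βu β₁ ℓ₁ c₃ : ℝ} (hℓ₁ : 0 < ℓ₁) (hc₃ : 0 < c₃)
    (hpos : ∀ (L : ℕ) [NeZero L] (β : ℝ) (n : ℕ), βu ≤ β → 1 ≤ n → 8 * n ≤ L → 0 < kappa3 r L β n)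
    (hR : ∀ (L : ℕ) [NeZero L] (β : ℝ), β₁ ≤ β → (L : ℝ) * a β ≤ ℓ₁ → ∀ n : ℕ, 1 ≤ n → 8 * n ≤ L →
      c₃ * wCov r L β (plaq r L 0 0 1) (plaq r L (Pi.single (2 : Fin 4) ((n : ℕ) : ZMod L)) 0 1) *
          Real.sqrt (wCov r L β (plaq r L 0 0 1) (plaq r L (Pi.single (2 : Fin 4) ((n : ℕ) : ZMod L)) 0 1)) ≤
        kappa3 r L β n)
    (L₀ : ℕ) {ε : ℝ} (hε : 0 < ε) :
    ∃ δ : ℝ, 0 < δ ∧ ∀ (L : ℕ) [NeZero L] (β : ℝ) (n : ℕ), max βu β₁ ≤ β → 1 ≤ n → 8 * n ≤ L → L ≤ L₀ →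
      ε ≤ (n : ℝ) ^ 8 * wCov r L β (plaq r L 0 0 1) (plaq r L (Pi.single (2 : Fin 4) ((n : ℕ) : ZMod L)) 0 1) →
      δ ≤ (n : ℝ) ^ 12 * |kappa3 r L β n| := by
  rcases Nat.eq_zero_or_pos L₀ with hL₀ | hL₀
  · -- no torus has `L ≤ 0`
    subst hL₀
    refine ⟨1, one_pos, ?_⟩
    intro L _ β n _ _ _ hL _
    exact absurd (Nat.le_zero.1 hL) (NeZero.ne L)
  have hL₀' : (0 : ℝ) < L₀ := by exact_mod_cast hL₀
  -- beyond `B`, every torus `L ≤ L₀` is femto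
  obtain ⟨B, hB⟩ := Filter.eventually_atTop.1 (ha.eventually_mem (Iio_mem_nhds (div_pos hℓ₁ hL₀')))
  obtain ⟨δ₁, hδ₁, h₁⟩ := floor_on_compact_window r hpos B L₀
  have hδ₂ : 0 < c₃ * (ε * Real.sqrt ε) := mul_pos hc₃ (mul_pos hε (Real.sqrt_pos.2 hε))
  refine ⟨min δ₁ (c₃ * (ε * Real.sqrt ε)), lt_min hδ₁ hδ₂, ?_⟩
  intro L _ β n hβ hn h8 hL hεC
  have hβu : βu ≤ β := le_trans (le_max_left _ _) hβ
  have hβ₁ : β₁ ≤ β := le_trans (le_max_right _ _) hβ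
  by_cases hfem : (L : ℝ) * a β ≤ ℓ₁
  · exact (min_le_right _ _).trans (floor_of_rigidity r a hc₃.le hR hε.le L β n hβ₁ hfem hn h8 hεC)
  · -- not femto at a volume `L ≤ L₀` forces `β ≤ B`
    have hβB : β ≤ B := by
      by_contra hlt
      have haβ : a β ∈ Set.Iio (ℓ₁ / L₀) := hB β (le_of_lt (not_le.1 hlt))
      have haβ' : a β * L₀ < ℓ₁ := (lt_div_iff₀ hL₀').1 haβ
      have hLle : (L : ℝ) ≤ L₀ := by exact_mod_cast hL
      have hLpos : (0 : ℝ) < L := by exact_mod_cast Nat.pos_of_ne_zero (NeZero.ne L)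
      have hapos : 0 < a β := by
        by_contra hle
        have h0 : (L : ℝ) * a β ≤ 0 := mul_nonpos_iff.2 (Or.inl ⟨hLpos.le, not_lt.1 hle⟩)
        exact hfem (h0.trans hℓ₁.le)
      have hlt' : (L : ℝ) * a β < ℓ₁ :=
        calc (L : ℝ) * a β ≤ (L₀ : ℝ) * a β := mul_le_mul_of_nonneg_right hLle hapos.le
          _ = a β * L₀ := mul_comm _ _
          _ < ℓ₁ := haβ'
      exact hfem hlt'.le
    exact (min_le_left _ _).trans (h₁ L β n hβu hβB hn h8 hL)

/-- **The stub reduces to its large-volume, non-femto core.**  Under the global sign (`β ≥ β_u`), signed femto rigidity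
(`β ≥ β₁`, `L·a(β) ≤ ℓ₁`) and `a → 0`, the full a-free floor above `max (max β_u β₁) β₂` — the shape of the conclusion
`SkewnessFloor r` of stub `InfraredFloor` — follows from the floor on the RESIDUAL WINDOW alone (`hfar`): for each
`ε > 0`, a `δ > 0` and a volume `L₀` beyond which `n⁸Cov ≥ ε ⇒ n¹²|κ₃| ≥ δ` at the NON-femto couplings `β ≥ β₂`,
`L·a(β) > ℓ₁` — large boxes at confinement-scale separations.  The converse implication is trivial, so modulo §§1–3
this residual is exactly the open content of the stub (infrared volume/cutoff uniformity of the three-point function). -/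
theorem floor_of_floor_at_large_volumes (r : LatticeRep G) {a : ℝ → ℝ} (ha : Tendsto a atTop (𝓝 0))
    {βu β₁ β₂ ℓ₁ c₃ : ℝ} (hℓ₁ : 0 < ℓ₁) (hc₃ : 0 < c₃)
    (hpos : ∀ (L : ℕ) [NeZero L] (β : ℝ) (n : ℕ), βu ≤ β → 1 ≤ n → 8 * n ≤ L → 0 < kappa3 r L β n)
    (hR : ∀ (L : ℕ) [NeZero L] (β : ℝ), β₁ ≤ β → (L : ℝ) * a β ≤ ℓ₁ → ∀ n : ℕ, 1 ≤ n → 8 * n ≤ L →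
      c₃ * wCov r L β (plaq r L 0 0 1) (plaq r L (Pi.single (2 : Fin 4) ((n : ℕ) : ZMod L)) 0 1) *
          Real.sqrt (wCov r L β (plaq r L 0 0 1) (plaq r L (Pi.single (2 : Fin 4) ((n : ℕ) : ZMod L)) 0 1)) ≤
        kappa3 r L β n)
    (hfar : ∀ ε : ℝ, 0 < ε → ∃ δ : ℝ, 0 < δ ∧ ∃ L₀ : ℕ, ∀ (L : ℕ) [NeZero L] (β : ℝ) (n : ℕ),
      L₀ < L → β₂ ≤ β → ℓ₁ < (L : ℝ) * a β → 1 ≤ n → 8 * n ≤ L →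
        ε ≤ (n : ℝ) ^ 8 * wCov r L β (plaq r L 0 0 1) (plaq r L (Pi.single (2 : Fin 4) ((n : ℕ) : ZMod L)) 0 1) →
        δ ≤ (n : ℝ) ^ 12 * |kappa3 r L β n|) :
    ∀ ε : ℝ, 0 < ε → ∃ δ : ℝ, 0 < δ ∧ ∀ (L : ℕ) [NeZero L] (β : ℝ) (n : ℕ),
      max (max βu β₁) β₂ ≤ β → 1 ≤ n → 8 * n ≤ L →
        ε ≤ (n : ℝ) ^ 8 * wCov r L β (plaq r L 0 0 1) (plaq r L (Pi.single (2 : Fin 4) ((n : ℕ) : ZMod L)) 0 1) →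
        δ ≤ (n : ℝ) ^ 12 * |kappa3 r L β n| := by
  intro ε hε
  obtain ⟨δ₃, hδ₃, L₀, h₃⟩ := hfar ε hε
  obtain ⟨δ₁, hδ₁, h₁⟩ := floor_on_bounded_volumes r ha hℓ₁ hc₃ hpos hR L₀ hε
  have hδ₂ : 0 < c₃ * (ε * Real.sqrt ε) := mul_pos hc₃ (mul_pos hε (Real.sqrt_pos.2 hε))
  refine ⟨min δ₁ (min (c₃ * (ε * Real.sqrt ε)) δ₃), lt_min hδ₁ (lt_min hδ₂ hδ₃), ?_⟩
  intro L _ β n hβ hn h8 hεC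
  have hβ01 : max βu β₁ ≤ β := le_trans (le_max_left _ _) hβ
  have hβ₁ : β₁ ≤ β := le_trans (le_max_right _ _) hβ01
  have hβ₂ : β₂ ≤ β := le_trans (le_max_right _ _) hβ
  rcases le_or_gt L L₀ with hL | hL
  · exact (min_le_left _ _).trans (h₁ L β n hβ01 hn h8 hL hεC)
  · by_cases hfem : (L : ℝ) * a β ≤ ℓ₁
    · exact ((min_le_right _ _).trans (min_le_left _ _)).trans
        (floor_of_rigidity r a hc₃.le hR hε.le L β n hβ₁ hfem hn h8 hεC)
    · exact ((min_le_right _ _).trans (min_le_right _ _)).trans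
        (h₃ L β n hL hβ₂ (not_le.1 hfem) hn h8 hεC)

end Summit.QuantumFields.YangMills.Theorems.FemtoCurvatureSkewness

end
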